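import Summits.HubbardSuperconductivity.HubbardSuperconductivity.Theorems.AnisotropyChordTransferFibre3FinPiCell

/-!
# Route `AnisotropyChord` / H0 rotor rung: FIN layer 2b — GRADIENT tables on a λ-cell (per-momentum differences) and the sharpened `T⁺`/`mHole` cell checker

The position-space evaluator of layer 2 (`…Fibre3FinPiCell`) reads the gradients `D_e f(r) = f(r) − f(r−e)` of the ground profile
as differences of two table entries, so their enclosure width is twice the width of `f` over the cell although `D_e f` itself is
small; this forces narrow λ-cells (≈ 65 at `L = 9`).  Here the gradient of the explicit profile `groundF L λ` is enclosed through
its structure, `f(r) − f(s) = −c_s·(G̃_λ(r) − G̃_λ(s))` off the origin, with the kernel difference evaluated PER MOMENTUM,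
`G̃_λ(r) − G̃_λ(s) = (1/V)Σ_{k≠0}(cos k·r − cos k·s)·g_λ(k)` — the cell dependence enters only through `g_λ(k) ∈ [g_{λa}(k), g_{λb}(k)]`,
so the width scales with the gradient, not with the value (≈ 13 cells at `L = 9` in the prover's float mirror `scratch/fin_iv2.py`):
* `dgreenIv` / ★ `mem_dgreen_of` — g3's double sum with the two-cosine weight, generic in the reciprocal table; `GdiffCellIv`,
  ★ `mem_Gdiff_cell`;
* `dIv2` (origin cases from the profile table, otherwise `−c_s·GdiffCellIv`), ★ `mem_dIv2`;
* `brIvD` / `c0IvD` / `SIvD` — layer 2's bracket / cross term / `Σ_c Π⁰·C0` with an ABSTRACT gradient oracle `dF`, soundness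
  `mem_brIvD` / `mem_c0IvD` / ★ `mem_SIvD` given `TabEncl` and an oracle hypothesis;
* the sharpened cell checker `tplusIv2`, `mholeCellOK2`, `cellsOK2`, `mholeCheck2` (soundness and kernel facts: next, def-free, file).
Prover seat `hubbard-h0-rotor-p3` g4; helper for stmt-HubbardSuperconductivity-23918 (piece A of rung 19089; `--supports`, helper class).
WHAT THIS IS NOT: nothing here proves superconductivity in the Hubbard model (rotor TARGET as worded stays FALSE, g15 verdict); it is
evaluator infrastructure for the FIN certificates (regime clause `mHole ≥ 0`) of ONE conditional reduction. Tree imports only; no sorry.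
-/

set_option linter.dupNamespace false
set_option autoImplicit false

namespace Summit.HubbardSuperconductivity.HubbardSuperconductivity.Theorems.AnisotropyChord.Transfer.Fibre3

namespace FinCell

open scoped BigOperators
open Finset Hole2

/-! ## Layer 0b: two-cosine weighted double sums (computable, zero data) -/

/-- one row of the difference sum: `Σ_{k₂<n, k≠0} (cos(k·r) − cos(k·s))·et[k₁][k₂]`. [folklore] -/
def dRow (L : ℕ) (ct erow : List Iv) (r1 r2 s1 s2 k1 : ℕ) : ℕ → Iv
  | 0 => (0, 0)
  | k2 + 1 =>
      if k1 = 0 ∧ k2 = 0 then dRow L ct erow r1 r2 s1 s2 k1 k2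
      else iadd (dRow L ct erow r1 r2 s1 s2 k1 k2)
        (imul (isub (getIv ct ((k1 * r1 + k2 * r2) % L)) (getIv ct ((k1 * s1 + k2 * s2) % L))) (getIv erow k2))

/-- the spine over rows. [folklore] -/
def dSum (L : ℕ) (ct : List Iv) (et : List (List Iv)) (r1 r2 s1 s2 : ℕ) : ℕ → Iv
  | 0 => (0, 0)
  | k1 + 1 => iadd (dSum L ct et r1 r2 s1 s2 k1) (dRow L ct (et.getD k1 []) r1 r2 s1 s2 k1 L)

/-- `(1/V)Σ_{k≠0} (cos(k·r) − cos(k·s))·et(k)`. [folklore] -/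
def dgreenIv (L : ℕ) (ct : List Iv) (et : List (List Iv)) (r1 r2 s1 s2 : ℕ) : Iv :=
  idivn (dSum L ct et r1 r2 s1 s2 L) ((L : ℤ) * L)

/-- ★ `G̃_λ(r) − G̃_λ(s)` on the cell, per momentum. [folklore] -/
def GdiffCellIv (L : ℕ) (la lb : ℤ) (r1 r2 s1 s2 : ℕ) : Iv :=
  dgreenIv L (cosTab L) (gresCellTab L (cosTab L) la lb) r1 r2 s1 s2

/-! ## Layer 2b: gradients of the ground profile through the kernel differences -/

/-- `D_e f(r)` for `f = groundF L λ` on the cell: table difference at the origin cases, `−c_s·(G̃(r) − G̃(r−e))` otherwise. [folklore] -/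
def dIv2 (L : ℕ) (la lb : ℤ) (ft : List (List Iv)) (e1 e2 r1 r2 : ℕ) : Iv :=
  if (r1 = 0 ∧ r2 = 0) ∨ (subm L r1 e1 = 0 ∧ subm L r2 e2 = 0) then
    isub (getF ft r1 r2) (getF ft (subm L r1 e1) (subm L r2 e2))
  else ineg (imul (csIv L la lb) (GdiffCellIv L la lb r1 r2 (subm L r1 e1) (subm L r2 e2)))

/-- the bracket of direction `e` with an abstract gradient oracle `dF e₁ e₂ r₁ r₂ ∋ D_e f(r)`. [folklore] -/
def brIvD (L : ℕ) (ft : List (List Iv)) (dF : ℕ → ℕ → ℕ → ℕ → Iv) (e1 e2 a1 a2 b1 b2 : ℕ) : Iv :=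
  iadd (iadd
    (imul (imul (getF ft (subm L b1 a1) (subm L b2 a2)) (dF e1 e2 a1 a2)) (dF e1 e2 b1 b2))
    (imul (imul (getF ft b1 b2) (dF ((L - e1) % L) ((L - e2) % L) a1 a2)) (dF e1 e2 (subm L b1 a1) (subm L b2 a2))))
    (imul (imul (getF ft a1 a2) (dF e1 e2 b1 b2)) (dF e1 e2 (subm L b1 a1) (subm L b2 a2)))

/-- the cross term with the gradient oracle. [folklore] -/
def c0IvD (L : ℕ) (ft : List (List Iv)) (dF : ℕ → ℕ → ℕ → ℕ → Iv) (a1 a2 b1 b2 : ℕ) : Iv :=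
  idivn (ineg (iadd (iadd (iadd (brIvD L ft dF 1 0 a1 a2 b1 b2) (brIvD L ft dF ((L - 1) % L) 0 a1 a2 b1 b2))
    (brIvD L ft dF 0 1 a1 a2 b1 b2)) (brIvD L ft dF 0 ((L - 1) % L) a1 a2 b1 b2))) 2

/-- `S = Σ_c Π⁰(c)·C0(c)` with the gradient oracle. [folklore] -/
def SIvD (L : ℕ) (ft : List (List Iv)) (dF : ℕ → ℕ → ℕ → ℕ → Iv) : Iv :=
  sum4 L fun a1 a2 b1 b2 => imul (piIv L ft a1 a2 b1 b2) (c0IvD L ft dF a1 a2 b1 b2)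

/-- the gradient table of one direction `(e₁,e₂)` (tabulated once per cell: the kernel shares the list, it does not memoise calls). [folklore] -/
def gTab (L : ℕ) (la lb : ℤ) (ft : List (List Iv)) (e1 e2 : ℕ) : List (List Iv) :=
  (List.range L).map fun r1 => (List.range L).map fun r2 => dIv2 L la lb ft e1 e2 r1 r2

/-- the gradient oracle: table lookups for the four lattice directions, direct evaluation otherwise (never reached). [folklore] -/
def dOracle (L : ℕ) (la lb : ℤ) (ft t10 tm0 t01 t0m : List (List Iv)) (e1 e2 r1 r2 : ℕ) : Iv :=
  if e1 = 1 ∧ e2 = 0 then getF t10 r1 r2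
  else if e1 = (L - 1) % L ∧ e2 = 0 then getF tm0 r1 r2
  else if e1 = 0 ∧ e2 = 1 then getF t01 r1 r2
  else if e1 = 0 ∧ e2 = (L - 1) % L then getF t0m r1 r2
  else dIv2 L la lb ft e1 e2 r1 r2

/-- the oracle of the cell: the profile table and the four gradient tables. [folklore] -/
def cellOracle (L : ℕ) (la lb : ℤ) : ℕ → ℕ → ℕ → ℕ → Iv :=
  dOracle L la lb (fTab L la lb)
    (gTab L la lb (fTab L la lb) 1 0) (gTab L la lb (fTab L la lb) ((L - 1) % L) 0)
    (gTab L la lb (fTab L la lb) 0 1) (gTab L la lb (fTab L la lb) 0 ((L - 1) % L))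

/-- `T⁺ = 3λ + S/N` on the cell, gradients through the kernel differences. [folklore] -/
def tplusIv2 (L : ℕ) (la lb : ℤ) : Iv :=
  iadd (iscale 3 (la, lb)) (imul (SIvD L (fTab L la lb) (cellOracle L la lb)) (iinv (NIv L (fTab L la lb))))

/-- one cell of the sharpened regime certificate. [folklore] -/
def mholeCellOK2 (L : ℕ) (la lb : ℤ) : Bool :=
  groundCellCheck L la lb &&
    (decide ((deltaIv L la lb).2 < 0) ||
      (decide (0 < (NIv L (fTab L la lb)).1) && decide ((tplusIv2 L la lb).2 ≤ (boundIv L).1)))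

/-- consecutive cells all pass (sharpened). [folklore] -/
def cellsOK2 (L : ℕ) : List ℤ → Bool
  | [] => true
  | [_] => true
  | a :: b :: rest => mholeCellOK2 L a b && cellsOK2 L (b :: rest)

/-- the last point of a cell list (`0` for the empty list). [folklore] -/
def cellsLast : List ℤ → ℤ
  | [] => 0
  | [a] => a
  | _ :: b :: rest => cellsLast (b :: rest)

/-- ★ the sharpened per-`L` regime certificate: at least two points, starting at `0`, pairwise checked, last point `≥ lamTop L`. [folklore] -/
def mholeCheck2 (L : ℕ) (cells : List ℤ) : Bool :=
  decide (cells.head? = some 0) && decide (2 ≤ cells.length) && decide (lamTop L ≤ cellsLast cells) && cellsOK2 L cells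

/-! ## Soundness of layer 0b -/

/-- the two-cosine weighted summand. [folklore] -/
noncomputable def dwterm (L : ℕ) (w : ℕ → ℕ → ℝ) (r1 r2 s1 s2 k1 k2 : ℕ) : ℝ :=
  if k1 = 0 ∧ k2 = 0 then 0 else
    (Real.cos (2 * Real.pi * ((k1 * r1 + k2 * r2) % L : ℕ) / L)
      - Real.cos (2 * Real.pi * ((k1 * s1 + k2 * s2) % L : ℕ) / L)) * w k1 k2

/-- `dwterm = wterm(r) − wterm(s)`. [folklore] -/
theorem dwterm_eq (L : ℕ) (w : ℕ → ℕ → ℝ) (r1 r2 s1 s2 k1 k2 : ℕ) :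
    dwterm L w r1 r2 s1 s2 k1 k2 = wterm L w r1 r2 k1 k2 - wterm L w s1 s2 k1 k2 := by
  unfold dwterm wterm
  by_cases hk : k1 = 0 ∧ k2 = 0
  · rw [if_pos hk, if_pos hk, if_pos hk, sub_zero]
  · rw [if_neg hk, if_neg hk, if_neg hk]; ring

/-- each summand is enclosed. [folklore] -/
theorem mem_dwterm (L : ℕ) (hL : 3 ≤ L) (w : ℕ → ℕ → ℝ) (et : List (List Iv))
    (hent : ∀ k1 k2 : ℕ, k1 < L → k2 < L → ¬ (k1 = 0 ∧ k2 = 0) → mem (w k1 k2) (getIv (et.getD k1 []) k2))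
    (r1 r2 s1 s2 : ℕ) {k1 k2 : ℕ} (hk1 : k1 < L) (hk2 : k2 < L) (hk : ¬ (k1 = 0 ∧ k2 = 0)) :
    mem (dwterm L w r1 r2 s1 s2 k1 k2)
      (imul (isub (getIv (cosTab L) ((k1 * r1 + k2 * r2) % L)) (getIv (cosTab L) ((k1 * s1 + k2 * s2) % L)))
        (getIv (et.getD k1 []) k2)) := by
  have hL0 : 0 < L := by omega
  unfold dwterm
  rw [if_neg hk]
  have hm : (k1 * r1 + k2 * r2) % L < L := Nat.mod_lt _ hL0
  have hm' : (k1 * s1 + k2 * s2) % L < L := Nat.mod_lt _ hL0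
  rw [getIv_cosTab hm, getIv_cosTab hm']
  exact mem_imul (mem_isub (mem_cosIv hL hm) (mem_cosIv hL hm')) (hent k1 k2 hk1 hk2 hk)

/-- row induction. [folklore] -/
theorem mem_dRow_of (L : ℕ) (hL : 3 ≤ L) (w : ℕ → ℕ → ℝ) (et : List (List Iv))
    (hent : ∀ k1 k2 : ℕ, k1 < L → k2 < L → ¬ (k1 = 0 ∧ k2 = 0) → mem (w k1 k2) (getIv (et.getD k1 []) k2))
    (r1 r2 s1 s2 : ℕ) {k1 : ℕ} (hk1 : k1 < L) : ∀ n : ℕ, n ≤ L →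
      mem (∑ k2 ∈ range n, dwterm L w r1 r2 s1 s2 k1 k2) (dRow L (cosTab L) (et.getD k1 []) r1 r2 s1 s2 k1 n) := by
  intro n
  induction n with
  | zero =>
    intro _
    rw [Finset.sum_range_zero]
    have := mem_exact 0
    push_cast at this
    rw [zero_div] at this
    exact this
  | succ n ih =>
    intro hn
    have hn' : n < L := hn
    rw [Finset.sum_range_succ]
    unfold dRow
    by_cases hk : k1 = 0 ∧ n = 0
    · rw [if_pos hk]
      have hz : dwterm L w r1 r2 s1 s2 k1 n = 0 := by unfold dwterm; rw [if_pos hk]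
      rw [hz, add_zero]
      exact ih (by omega)
    · rw [if_neg hk]
      exact mem_iadd (ih (by omega)) (mem_dwterm L hL w et hent r1 r2 s1 s2 hk1 hn' hk)

/-- spine induction. [folklore] -/
theorem mem_dSum_of (L : ℕ) (hL : 3 ≤ L) (w : ℕ → ℕ → ℝ) (et : List (List Iv))
    (hent : ∀ k1 k2 : ℕ, k1 < L → k2 < L → ¬ (k1 = 0 ∧ k2 = 0) → mem (w k1 k2) (getIv (et.getD k1 []) k2))
    (r1 r2 s1 s2 : ℕ) : ∀ n : ℕ, n ≤ L →
      mem (∑ k1 ∈ range n, ∑ k2 ∈ range L, dwterm L w r1 r2 s1 s2 k1 k2) (dSum L (cosTab L) et r1 r2 s1 s2 n) := by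
  intro n
  induction n with
  | zero =>
    intro _
    rw [Finset.sum_range_zero]
    have := mem_exact 0
    push_cast at this
    rw [zero_div] at this
    exact this
  | succ n ih =>
    intro hn
    rw [Finset.sum_range_succ]
    unfold dSum
    exact mem_iadd (ih (by omega)) (mem_dRow_of L hL w et hent r1 r2 s1 s2 (show n < L from hn) L le_rfl)

/-- ★ GENERIC SOUNDNESS of the two-cosine double sum. [folklore] -/
theorem mem_dgreen_of (L : ℕ) (hL : 3 ≤ L) (w : ℕ → ℕ → ℝ) (et : List (List Iv))
    (hent : ∀ k1 k2 : ℕ, k1 < L → k2 < L → ¬ (k1 = 0 ∧ k2 = 0) → mem (w k1 k2) (getIv (et.getD k1 []) k2))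
    (r1 r2 s1 s2 : ℕ) :
    mem ((∑ k1 ∈ range L, ∑ k2 ∈ range L, dwterm L w r1 r2 s1 s2 k1 k2) / (L : ℝ) ^ 2)
      (dgreenIv L (cosTab L) et r1 r2 s1 s2) := by
  unfold dgreenIv
  have hLL : (0 : ℤ) < (L : ℤ) * L := by
    have : (0 : ℤ) < L := by exact_mod_cast (show 0 < L by omega)
    positivity
  have h := mem_idivn (mem_dSum_of L hL w et hent r1 r2 s1 s2 L le_rfl) hLL
  push_cast at h
  rw [sq]
  exact h

/-- ★ `G̃_λ(r) − G̃_λ(s) ∈ GdiffCellIv` on the cell (`r_i, s_i < L`). [folklore] -/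
theorem mem_Gdiff_cell (L : ℕ) [NeZero L] (hL : 3 ≤ L) {lam : ℝ} {la lb : ℤ}
    (hla : (la : ℝ) ≤ lam * ((D : ℤ) : ℝ)) (hlb : lam * ((D : ℤ) : ℝ) ≤ (lb : ℝ))
    (hpos : denCellPos L (cosTab L) la lb = true) {r1 r2 s1 s2 : ℕ}
    (h1 : r1 < L) (h2 : r2 < L) (hs1 : s1 < L) (hs2 : s2 < L) :
    mem (Gres L lam (((r1 : ℕ) : ZMod L), ((r2 : ℕ) : ZMod L)) - Gres L lam (((s1 : ℕ) : ZMod L), ((s2 : ℕ) : ZMod L)))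
      (GdiffCellIv L la lb r1 r2 s1 s2) := by
  rw [Gres_eq_sum L lam h1 h2, Gres_eq_sum L lam hs1 hs2, ← sub_div, ← Finset.sum_sub_distrib]
  have e : ∑ k1 ∈ range L, (∑ k2 ∈ range L, wterm L (gw L lam) r1 r2 k1 k2 - ∑ k2 ∈ range L, wterm L (gw L lam) s1 s2 k1 k2)
      = ∑ k1 ∈ range L, ∑ k2 ∈ range L, dwterm L (gw L lam) r1 r2 s1 s2 k1 k2 := by
    refine Finset.sum_congr rfl fun k1 _ => ?_
    rw [← Finset.sum_sub_distrib]
    refine Finset.sum_congr rfl fun k2 _ => ?_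
    rw [dwterm_eq]
  rw [e]
  unfold GdiffCellIv
  exact mem_dgreen_of L hL (gw L lam) _ (mem_gresCellTab L hL hla hlb hpos) r1 r2 s1 s2

/-! ## Soundness of layer 2b -/

variable {L : ℕ} [NeZero L]

/-- off the origin, the gradient of `groundF` is `−c_s` times a kernel difference. [folklore] -/
theorem groundF_sub (lam : ℝ) {r s : Tor L} (hr : r ≠ 0) (hs : s ≠ 0) :
    groundF L lam r - groundF L lam s = -(groundCs L lam * (Gres L lam r - Gres L lam s)) := by
  unfold groundF aKer
  rw [if_neg hr, if_neg hs]
  ring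

/-- ★ the gradient oracle `dIv2` encloses `D_e (groundF L λ)` on the cell (`e`, `r` by natural coordinates `< L`). [folklore] -/
theorem mem_dIv2 (hL : 3 ≤ L) {lam : ℝ} (hlam : 0 < lam) {la lb : ℤ}
    (hla : (la : ℝ) ≤ lam * ((D : ℤ) : ℝ)) (hlb : lam * ((D : ℤ) : ℝ) ≤ (lb : ℝ))
    (hchk : groundCellCheck L la lb = true) {e1 e2 r1 r2 : ℕ}
    (he1 : e1 < L) (he2 : e2 < L) (hr1 : r1 < L) (hr2 : r2 < L) :
    mem (Dgrad L (groundF L lam) ((((e1 : ℕ) : ZMod L)), (((e2 : ℕ) : ZMod L)))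
          ((((r1 : ℕ) : ZMod L)), (((r2 : ℕ) : ZMod L))))
      (dIv2 L la lb (fTab L la lb) e1 e2 r1 r2) := by
  have hL0 : 0 < L := by omega
  have hft := tabEncl_fTab hL hlam hla hlb hchk
  obtain ⟨hpos, _, _⟩ := groundCellCheck_spec hchk
  unfold dIv2
  by_cases hc : (r1 = 0 ∧ r2 = 0) ∨ (subm L r1 e1 = 0 ∧ subm L r2 e2 = 0)
  · rw [if_pos hc]
    exact mem_dIv hft he1 he2 hr1 hr2
  · rw [if_neg hc]
    push Not at hc
    obtain ⟨hc1, hc2⟩ := hc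
    have hs1 := subm_lt L r1 e1 hL0
    have hs2 := subm_lt L r2 e2 hL0
    have hr : ((((r1 : ℕ) : ZMod L), (((r2 : ℕ) : ZMod L))) : Tor L) ≠ 0 := by
      rw [Ne, Prod.mk_eq_zero, natCast_zmod_eq_zero L hr1, natCast_zmod_eq_zero L hr2]
      exact fun h => hc1 h.1 h.2
    have hs : ((((subm L r1 e1 : ℕ) : ZMod L), (((subm L r2 e2 : ℕ) : ZMod L))) : Tor L) ≠ 0 := by
      rw [Ne, Prod.mk_eq_zero, natCast_zmod_eq_zero L hs1, natCast_zmod_eq_zero L hs2]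
      exact fun h => hc2 h.1 h.2
    unfold Dgrad
    rw [pt_sub e1 e2 r1 r2 he1 he2, groundF_sub lam hr hs]
    exact mem_ineg (mem_imul (mem_groundCs_cell L hL hlam hla hlb hchk)
      (mem_Gdiff_cell L hL hla hlb hpos hr1 hr2 hs1 hs2))

/-- ★ the cell oracle encloses `D_e (groundF L λ)` for every direction given by natural coordinates `< L`. [folklore] -/
theorem mem_cellOracle (hL : 3 ≤ L) {lam : ℝ} (hlam : 0 < lam) {la lb : ℤ}
    (hla : (la : ℝ) ≤ lam * ((D : ℤ) : ℝ)) (hlb : lam * ((D : ℤ) : ℝ) ≤ (lb : ℝ))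
    (hchk : groundCellCheck L la lb = true) :
    ∀ e1 e2 r1 r2 : ℕ, e1 < L → e2 < L → r1 < L → r2 < L →
      mem (Dgrad L (groundF L lam) ((((e1 : ℕ) : ZMod L)), (((e2 : ℕ) : ZMod L)))
          ((((r1 : ℕ) : ZMod L)), (((r2 : ℕ) : ZMod L))))
        (cellOracle L la lb e1 e2 r1 r2) := by
  intro e1 e2 r1 r2 he1 he2 hr1 hr2
  unfold cellOracle dOracle
  have key : ∀ a b : ℕ, a < L → b < L →
      getF (gTab L la lb (fTab L la lb) a b) r1 r2 = dIv2 L la lb (fTab L la lb) a b r1 r2 := by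
    intro a b _ _
    unfold getF gTab
    exact getIv_tab (fun x y => dIv2 L la lb (fTab L la lb) a b x y) hr1 hr2
  split_ifs with h1 h2 h3 h4
  · obtain ⟨rfl, rfl⟩ := h1; rw [key 1 0 he1 he2]; exact mem_dIv2 hL hlam hla hlb hchk he1 he2 hr1 hr2
  · obtain ⟨rfl, rfl⟩ := h2; rw [key _ 0 he1 he2]; exact mem_dIv2 hL hlam hla hlb hchk he1 he2 hr1 hr2
  · obtain ⟨rfl, rfl⟩ := h3; rw [key 0 1 he1 he2]; exact mem_dIv2 hL hlam hla hlb hchk he1 he2 hr1 hr2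
  · obtain ⟨rfl, rfl⟩ := h4; rw [key 0 _ he1 he2]; exact mem_dIv2 hL hlam hla hlb hchk he1 he2 hr1 hr2
  · exact mem_dIv2 hL hlam hla hlb hchk he1 he2 hr1 hr2

omit [NeZero L] in
/-- the bracket with a sound gradient oracle is enclosed. [folklore] -/
theorem mem_brIvD {f : Tor L → ℝ} {ft : List (List Iv)} (hft : TabEncl L f ft) {dF : ℕ → ℕ → ℕ → ℕ → Iv}
    (hdF : ∀ e1 e2 r1 r2 : ℕ, e1 < L → e2 < L → r1 < L → r2 < L →
      mem (Dgrad L f ((((e1 : ℕ) : ZMod L)), (((e2 : ℕ) : ZMod L))) ((((r1 : ℕ) : ZMod L)), (((r2 : ℕ) : ZMod L))))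
        (dF e1 e2 r1 r2))
    {e1 e2 a1 a2 b1 b2 : ℕ}
    (he1 : e1 < L) (he2 : e2 < L) (ha1 : a1 < L) (ha2 : a2 < L) (hb1 : b1 < L) (hb2 : b2 < L) :
    let e : Tor L := ((((e1 : ℕ) : ZMod L)), (((e2 : ℕ) : ZMod L)))
    let e' : Tor L := (((((L - e1) % L : ℕ)) : ZMod L), ((((L - e2) % L : ℕ)) : ZMod L))
    let a : Tor L := ((((a1 : ℕ) : ZMod L)), (((a2 : ℕ) : ZMod L)))
    let b : Tor L := ((((b1 : ℕ) : ZMod L)), (((b2 : ℕ) : ZMod L)))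
    mem (f (b - a) * Dgrad L f e a * Dgrad L f e b + f b * Dgrad L f e' a * Dgrad L f e (b - a)
          + f a * Dgrad L f e b * Dgrad L f e (b - a))
      (brIvD L ft dF e1 e2 a1 a2 b1 b2) := by
  intro e e' a b
  have hL : 0 < L := by omega
  have hc1 := subm_lt L b1 a1 hL
  have hc2 := subm_lt L b2 a2 hL
  have hm1 : (L - e1) % L < L := Nat.mod_lt _ hL
  have hm2 : (L - e2) % L < L := Nat.mod_lt _ hL
  have hba : b - a = ((((subm L b1 a1 : ℕ)) : ZMod L), (((subm L b2 a2 : ℕ)) : ZMod L)) := pt_sub a1 a2 b1 b2 ha1 ha2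
  unfold brIvD
  rw [hba]
  exact mem_iadd (mem_iadd
    (mem_imul (mem_imul (hft _ _ hc1 hc2) (hdF e1 e2 a1 a2 he1 he2 ha1 ha2)) (hdF e1 e2 b1 b2 he1 he2 hb1 hb2))
    (mem_imul (mem_imul (hft b1 b2 hb1 hb2) (hdF _ _ a1 a2 hm1 hm2 ha1 ha2)) (hdF e1 e2 _ _ he1 he2 hc1 hc2)))
    (mem_imul (mem_imul (hft a1 a2 ha1 ha2) (hdF e1 e2 b1 b2 he1 he2 hb1 hb2)) (hdF e1 e2 _ _ he1 he2 hc1 hc2))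

/-- the cross term with a sound gradient oracle is enclosed. [folklore] -/
theorem mem_c0IvD (hL : 2 ≤ L) {f : Tor L → ℝ} {ft : List (List Iv)} (hft : TabEncl L f ft)
    {dF : ℕ → ℕ → ℕ → ℕ → Iv}
    (hdF : ∀ e1 e2 r1 r2 : ℕ, e1 < L → e2 < L → r1 < L → r2 < L →
      mem (Dgrad L f ((((e1 : ℕ) : ZMod L)), (((e2 : ℕ) : ZMod L))) ((((r1 : ℕ) : ZMod L)), (((r2 : ℕ) : ZMod L))))
        (dF e1 e2 r1 r2))
    {a1 a2 b1 b2 : ℕ} (ha1 : a1 < L) (ha2 : a2 < L) (hb1 : b1 < L) (hb2 : b2 < L) :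
    mem (c0Expr L f (((((a1 : ℕ) : ZMod L)), (((a2 : ℕ) : ZMod L))), ((((b1 : ℕ) : ZMod L)), (((b2 : ℕ) : ZMod L)))))
      (c0IvD L ft dF a1 a2 b1 b2) := by
  have h1 : 1 < L := by omega
  have h0 : 0 < L := by omega
  have hm : (L - 1) % L < L := Nat.mod_lt _ h0
  have hz : (L - 0) % L = 0 := by rw [Nat.sub_zero, Nat.mod_self]
  have hmm : (L - (L - 1) % L) % L = 1 := by
    rw [Nat.mod_eq_of_lt (show L - 1 < L by omega), show L - (L - 1) = 1 by omega]
    exact Nat.mod_eq_of_lt h1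
  obtain ⟨d1, -, d3, -⟩ := dirs_natCast hL
  unfold c0Expr c0IvD
  rw [nnList_map_sum]
  simp only
  rw [d1, d3]
  simp only [neg_neg]
  rw [neg_pt 1 0 h1 h0, neg_pt 0 1 h0 h1]
  simp only [hz]
  have hneg : ∀ x : ℝ, -(1 / 2 : ℝ) * x = -x / (2 : ℤ) := by intro x; push_cast; ring
  rw [hneg]
  refine mem_idivn (mem_ineg (mem_iadd (mem_iadd (mem_iadd ?_ ?_) ?_) ?_)) (by norm_num)
  · have := mem_brIvD hft hdF h1 h0 ha1 ha2 hb1 hb2 (e1 := 1) (e2 := 0)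
    simp only [hz] at this
    exact this
  · have := mem_brIvD hft hdF hm h0 ha1 ha2 hb1 hb2 (e1 := (L - 1) % L) (e2 := 0)
    simp only [hz, hmm] at this
    exact this
  · have := mem_brIvD hft hdF h0 h1 ha1 ha2 hb1 hb2 (e1 := 0) (e2 := 1)
    simp only [hz] at this
    exact this
  · have := mem_brIvD hft hdF h0 hm ha1 ha2 hb1 hb2 (e1 := 0) (e2 := (L - 1) % L)
    simp only [hz, hmm] at this
    exact this

/-- ★ `Σ_c Π⁰·C0fn ∈ SIvD` for a two-magnon profile, any enclosing table and any sound gradient oracle. [folklore] -/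
theorem mem_SIvD (hL : 2 ≤ L) {Δ lam2 : ℝ} {f : Tor L → ℝ} (hf : IsTwoMagnon L Δ lam2 f)
    {ft : List (List Iv)} (hft : TabEncl L f ft) {dF : ℕ → ℕ → ℕ → ℕ → Iv}
    (hdF : ∀ e1 e2 r1 r2 : ℕ, e1 < L → e2 < L → r1 < L → r2 < L →
      mem (Dgrad L f ((((e1 : ℕ) : ZMod L)), (((e2 : ℕ) : ZMod L))) ((((r1 : ℕ) : ZMod L)), (((r2 : ℕ) : ZMod L))))
        (dF e1 e2 r1 r2)) :
    mem (∑ c : Cfg L, piR L f c * C0fn L Δ lam2 f c) (SIvD L ft dF) := by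
  simp_rw [piR_mul_C0fn_eq hf]
  unfold SIvD
  rw [sum_cfg_range]
  refine mem_sum4 L _ _ fun a1 a2 b1 b2 ha1 ha2 hb1 hb2 => ?_
  exact mem_imul (mem_piIv hft ha1 ha2 hb1 hb2) (mem_c0IvD hL hft hdF ha1 ha2 hb1 hb2)

end FinCell

end Summit.HubbardSuperconductivity.HubbardSuperconductivity.Theorems.AnisotropyChord.Transfer.Fibre3
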